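/-
Copyright: cell `pub-balaban-gaps` (G2), seat ne6 (row NE7b), `prover-pub-balaban-gaps-ne6-g18-0`. Project licence.
-/
import Summits.QuantumFields.BalabanUV.T4Continuum.Spine.NE7b.CompactFibrePlaquetteMassSUNTangentFloor
import Summits.QuantumFields.BalabanUV.T4Continuum.Spine.NE7b.CompactFibrePlaquetteMassSU2Monotone
import Mathlib.LinearAlgebra.Matrix.Permutation

/-!
# THE FUNDAMENTAL CHARACTER OF `SU(N)` HAS HAAR NORM ONE, `∫ |tr U|² dHaar_{SU(N)}(U) = 1` (every `N ≥ 1`), AND `∫ (tr U)² dHaar = 0` (`N ≥ 3`) — FROM INVARIANCE ALONE;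
# hence the compact-fibre reference state's one-plaquette action `Re tr(1−U)` has MEAN `N` (V46) and VARIANCE `½` (`N ≥ 3`; `1` for `N = 2`), with the Chebyshev tail
# `Haar{|Re tr(1−U) − N| ≥ t} ≤ 1∕(2t²)` (row NE7b, node U5c; MODEL, [folklore]; census V51 — Schur orthogonality of the fundamental character, chart-free)

Cell `pub-balaban-gaps` (G2 spine census) for the `pub-balaban` T⁴ crux NE7b (`T4WeightBudget.RelWeightBound`; NOT PRINTED, NOT PROVED).  Crux-route work under `Spine/NE7b/`;
imports V46 `CompactFibrePlaquetteMassSUNTangentFloor` (import closure: the `SU(N)` instances of `Literature…QuantumLattice.GaugeGroups`, `haarProbability`, its left∕right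
invariance), V44 `CompactFibrePlaquetteMassSU2Monotone` (only for §6: V40e's `integral_haar_su2_classFun`, `setIntegral_Ioo_eq_intervalIntegral`) + Mathlib
`LinearAlgebra.Matrix.Permutation`; no `def`, zero `sorry`, nothing of Bałaban's asserted.  §§1–5 use no Weyl formula, no Peter–Weyl, no character theory.

THE LOCATED QUESTION (census V51).  V46: the reference state's MEAN action is `∫ Re tr(1−U) dHaar_{SU(N)} = N` (centre twist); V50: the monotone shape of the tilted mean.
QUESTION: what is the reference state's action FLUCTUATION — the second moment of the fundamental character under Haar — for every `N`, chart-free?  (Character theory: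
`∫|χ|² = 1`, `∫χ² = ⟨triv, V⊗V⟩ = 0` for `N ≥ 3`; neither is in the tree for `SU(N)`.)

ANSWER ([folklore]; invariance of Haar under three kinds of EXPLICIT elements of `SU(N)`):
* §1 `diagonal_mem_specialUnitaryGroup`, `twist_mem` (`T_{ij} = diag(I at i, −I at j)`), `tripleTwist_mem` (`E_{ijk} = diag(I, I, −1)`), `permMatrix_mem_unitaryGroup`,
  **`signedSwap_mem`** (`S_{ij} = P_{(ij)}·diag(−1 at i) ∈ SU(N)`, Mathlib `det_permutation` ∕ `conjTranspose_permMatrix`), `mul_signedSwap_apply` (`(M·S_{ij})_{a i} = −M_{a j}`).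
* §2 LEFT TWISTS (`integral_mul_left_eq_self`): `integral_diag_mul_conj_diag_twist`, `integral_diag_mul_diag_twist`, hence **`integral_diag_mul_conj_diag_eq_zero`** (`i ≠ j`:
  `∫ U_{ii}·conj(U_{jj}) = 0`), **`integral_diag_sq_eq_zero`** (`∫ U_{ii}² = 0`, `N ≥ 2`), **`integral_diag_mul_diag_eq_zero`** (`∫ U_{ii}U_{jj} = 0`, `i ≠ j`, a third index).
* §3 RIGHT SIGNED SWAP + UNITARITY (`integral_mul_right_eq_self`): **`integral_normSq_diag_eq_offdiag`** (`∫|U_{ii}|² = ∫|U_{ij}|²`), `sum_row_normSq_eq_one`,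
  **`integral_normSq_diag`** (`∫ |U_{ii}|² dHaar = 1∕N`).
* §4 **`integral_trace_mul_conj_trace`** — `∫ tr U·conj(tr U) dHaar_{SU(N)} = 1`, every `N ≥ 1`; **`integral_trace_sq_eq_zero`** — `∫ (tr U)² dHaar_{SU(N)} = 0`, `N ≥ 3`.
* §5 `re_sq_eq`, **`integral_re_trace_sq`** (`∫ (Re tr U)² = ½`, `N ≥ 3`), **`integral_sq_traceDeficit_sub_mean`** — THE ACTION VARIANCE `∫ (Re tr(1−U) − N)² dHaar_{SU(N)} = ½`,
  `N ≥ 3` —, `haarReal_sq_traceDeficit_sub_mean_ge_le` (Markov), **`haarReal_abs_traceDeficit_sub_mean_ge_le`** (Chebyshev `Haar{t ≤ |Re tr(1−U) − N|} ≤ 1∕(2t²)`).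
* §6 `N = 2` (V40e BY NAME + Mathlib `integral_sin_sq_mul_cos_sq`): **`integral_re_trace_sq_SU2`** (`= 1`), **`integral_sq_traceDeficit_sub_mean_SU2`** (variance `1`, `V ≅ V*`).

HONEST REMARKS.  (i) MODEL ∕ [folklore]: ONE plaquette variable under Haar (on the carrier's product reference state the action variance is `½·#bonds`, resp. `#bonds`);
nothing of the interacting measure, no tilted (`β > 0`) second moment.  (ii) (A3) ∕ (A1c) NOT asserted; NC-NE7b-α UNRULED.  BY-NAME EFFECT ON THE WALL: NONE.
NE7b NOT PRINTED ∕ NOT PROVED; spine PROVED 0∕9; rung (B)+1 on ONE finite T⁴ — NOT infinite volume, NOT the mass gap, NOT Clay.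
HONEST DEPENDENCY: continuum YM on T⁴ ⇐ BetaPertH ∧ nine spine estimates (0/9 proved); BetaPertH ⇐ (D1) ∧ (D4) ∧ CAP+tail;
G-an2-4 gates asym, D1 and NE2/3/4.  This file changes none of it.
-/

set_option autoImplicit false

noncomputable section

open MeasureTheory Real Set Filter Topology Matrix
open scoped Matrix.Norms.Frobenius ComplexConjugate
open Literature.MathematicalPhysics.QuantumFieldTheory (haarProbability)
open Summit.QuantumFields.BalabanUV.T4Continuum.NE7b.CompactFibreSU2ClassIntegral (integral_haar_su2_classFun)
open Summit.QuantumFields.BalabanUV.T4Continuum.NE7b.CompactFibrePlaquetteMassSU2Monotone (setIntegral_Ioo_eq_intervalIntegral)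

namespace Summit.QuantumFields.BalabanUV.T4Continuum.NE7b.CompactFibreCharacterNormSUN

variable {N : ℕ}

/-! ## §1 Elements of `SU(N)`: diagonal phase matrices and signed transpositions -/

/-- A diagonal matrix of unit-modulus phases with product `1` lies in `SU(N)`. [folklore] -/
theorem diagonal_mem_specialUnitaryGroup {d : Fin N → ℂ} (hd : ∀ i, d i * conj (d i) = 1) (hprod : ∏ i, d i = 1) :
    Matrix.diagonal d ∈ Matrix.specialUnitaryGroup (Fin N) ℂ := by
  rw [Matrix.mem_specialUnitaryGroup_iff]
  refine ⟨?_, by rw [Matrix.det_diagonal, hprod]⟩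
  rw [Matrix.mem_unitaryGroup_iff, Matrix.star_eq_conjTranspose, Matrix.diagonal_conjTranspose, Matrix.diagonal_mul_diagonal,
    ← Matrix.diagonal_one]
  congr 1; funext i
  rw [Pi.star_apply, Complex.star_def]; exact hd i

/-- The torus twist `T_{ij}`: `I` at `i`, `−I` at `j ≠ i`, `1` elsewhere — an element of `SU(N)`. [folklore] -/
theorem twist_mem {i j : Fin N} (hij : i ≠ j) :
    Matrix.diagonal (fun k : Fin N => if k = i then Complex.I else if k = j then -Complex.I else 1) ∈ Matrix.specialUnitaryGroup (Fin N) ℂ := by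
  refine diagonal_mem_specialUnitaryGroup (fun k => ?_) ?_
  · by_cases hk : k = i
    · simp [hk, Complex.conj_I]
    · by_cases hk' : k = j
      · simp [hk', hij.symm, Complex.conj_I]
      · simp [hk, hk']
  · rw [Finset.prod_eq_mul_of_mem (a := i) (b := j) (Finset.mem_univ _) (Finset.mem_univ _) hij]
    · simp [hij.symm]
    · intro k _ hk; simp [hk.1, hk.2]

/-- Entries of a left twist: `((⟨diagonal d, _⟩ : SU(N)) * U)ᵢⱼ = dᵢ·Uᵢⱼ`. [folklore] -/
theorem coe_diagonal_mul_apply {d : Fin N → ℂ} (hd : Matrix.diagonal d ∈ Matrix.specialUnitaryGroup (Fin N) ℂ)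
    (U : Matrix.specialUnitaryGroup (Fin N) ℂ) (a b : Fin N) :
    ((⟨Matrix.diagonal d, hd⟩ * U : Matrix.specialUnitaryGroup (Fin N) ℂ) : Matrix (Fin N) (Fin N) ℂ) a b = d a * (U : Matrix (Fin N) (Fin N) ℂ) a b := by
  rw [Submonoid.coe_mul, Matrix.diagonal_mul]

/-! ## §2 Invariance: integrals of entry products are unchanged by left twists -/

/-- **LEFT TWIST OF A DIAGONAL-ENTRY PRODUCT**: for a diagonal `D ∈ SU(N)` with phases `d`,
`∫ Uᵢᵢ·conj(Uⱼⱼ) dHaar = dᵢ·conj(dⱼ)·∫ Uᵢᵢ·conj(Uⱼⱼ) dHaar` (left invariance of Haar). [folklore] -/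
theorem integral_diag_mul_conj_diag_twist {d : Fin N → ℂ} (hd : Matrix.diagonal d ∈ Matrix.specialUnitaryGroup (Fin N) ℂ) (i j : Fin N) :
    ∫ U, (U : Matrix (Fin N) (Fin N) ℂ) i i * conj ((U : Matrix (Fin N) (Fin N) ℂ) j j) ∂(haarProbability (Matrix.specialUnitaryGroup (Fin N) ℂ))
      = d i * conj (d j) * ∫ U, (U : Matrix (Fin N) (Fin N) ℂ) i i * conj ((U : Matrix (Fin N) (Fin N) ℂ) j j) ∂(haarProbability (Matrix.specialUnitaryGroup (Fin N) ℂ)) := by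
  set g : Matrix.specialUnitaryGroup (Fin N) ℂ := ⟨Matrix.diagonal d, hd⟩ with hg
  have h := integral_mul_left_eq_self (μ := haarProbability (Matrix.specialUnitaryGroup (Fin N) ℂ))
    (fun U : Matrix.specialUnitaryGroup (Fin N) ℂ => (U : Matrix (Fin N) (Fin N) ℂ) i i * conj ((U : Matrix (Fin N) (Fin N) ℂ) j j)) g
  calc ∫ U, (U : Matrix (Fin N) (Fin N) ℂ) i i * conj ((U : Matrix (Fin N) (Fin N) ℂ) j j) ∂(haarProbability (Matrix.specialUnitaryGroup (Fin N) ℂ))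
      = ∫ U, ((g * U : Matrix.specialUnitaryGroup (Fin N) ℂ) : Matrix (Fin N) (Fin N) ℂ) i i * conj (((g * U : Matrix.specialUnitaryGroup (Fin N) ℂ) : Matrix (Fin N) (Fin N) ℂ) j j)
          ∂(haarProbability (Matrix.specialUnitaryGroup (Fin N) ℂ)) := h.symm
    _ = ∫ U, d i * conj (d j) * ((U : Matrix (Fin N) (Fin N) ℂ) i i * conj ((U : Matrix (Fin N) (Fin N) ℂ) j j)) ∂(haarProbability (Matrix.specialUnitaryGroup (Fin N) ℂ)) := by
          refine integral_congr_ae (ae_of_all _ fun U => ?_)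
          simp only [hg, coe_diagonal_mul_apply, map_mul]
          ring
    _ = d i * conj (d j) * ∫ U, (U : Matrix (Fin N) (Fin N) ℂ) i i * conj ((U : Matrix (Fin N) (Fin N) ℂ) j j) ∂(haarProbability (Matrix.specialUnitaryGroup (Fin N) ℂ)) :=
          integral_const_mul _ _

/-- **LEFT TWIST OF A DIAGONAL-ENTRY PRODUCT (no conjugate)**: `∫ Uᵢᵢ·Uⱼⱼ dHaar = dᵢ·dⱼ·∫ Uᵢᵢ·Uⱼⱼ dHaar`. [folklore] -/
theorem integral_diag_mul_diag_twist {d : Fin N → ℂ} (hd : Matrix.diagonal d ∈ Matrix.specialUnitaryGroup (Fin N) ℂ) (i j : Fin N) :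
    ∫ U, (U : Matrix (Fin N) (Fin N) ℂ) i i * (U : Matrix (Fin N) (Fin N) ℂ) j j ∂(haarProbability (Matrix.specialUnitaryGroup (Fin N) ℂ))
      = d i * d j * ∫ U, (U : Matrix (Fin N) (Fin N) ℂ) i i * (U : Matrix (Fin N) (Fin N) ℂ) j j ∂(haarProbability (Matrix.specialUnitaryGroup (Fin N) ℂ)) := by
  set g : Matrix.specialUnitaryGroup (Fin N) ℂ := ⟨Matrix.diagonal d, hd⟩ with hg
  have h := integral_mul_left_eq_self (μ := haarProbability (Matrix.specialUnitaryGroup (Fin N) ℂ))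
    (fun U : Matrix.specialUnitaryGroup (Fin N) ℂ => (U : Matrix (Fin N) (Fin N) ℂ) i i * (U : Matrix (Fin N) (Fin N) ℂ) j j) g
  calc ∫ U, (U : Matrix (Fin N) (Fin N) ℂ) i i * (U : Matrix (Fin N) (Fin N) ℂ) j j ∂(haarProbability (Matrix.specialUnitaryGroup (Fin N) ℂ))
      = ∫ U, ((g * U : Matrix.specialUnitaryGroup (Fin N) ℂ) : Matrix (Fin N) (Fin N) ℂ) i i * ((g * U : Matrix.specialUnitaryGroup (Fin N) ℂ) : Matrix (Fin N) (Fin N) ℂ) j j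
          ∂(haarProbability (Matrix.specialUnitaryGroup (Fin N) ℂ)) := h.symm
    _ = ∫ U, d i * d j * ((U : Matrix (Fin N) (Fin N) ℂ) i i * (U : Matrix (Fin N) (Fin N) ℂ) j j) ∂(haarProbability (Matrix.specialUnitaryGroup (Fin N) ℂ)) := by
          refine integral_congr_ae (ae_of_all _ fun U => ?_)
          simp only [hg, coe_diagonal_mul_apply]
          ring
    _ = d i * d j * ∫ U, (U : Matrix (Fin N) (Fin N) ℂ) i i * (U : Matrix (Fin N) (Fin N) ℂ) j j ∂(haarProbability (Matrix.specialUnitaryGroup (Fin N) ℂ)) :=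
          integral_const_mul _ _

/-- **OFF-DIAGONAL ORTHOGONALITY**: for `i ≠ j`, `∫ Uᵢᵢ·conj(Uⱼⱼ) dHaar_{SU(N)} = 0` (the twist `T_{ij}` multiplies it by `I·conj(−I) = −1`). [folklore] -/
theorem integral_diag_mul_conj_diag_eq_zero {i j : Fin N} (hij : i ≠ j) :
    ∫ U, (U : Matrix (Fin N) (Fin N) ℂ) i i * conj ((U : Matrix (Fin N) (Fin N) ℂ) j j) ∂(haarProbability (Matrix.specialUnitaryGroup (Fin N) ℂ)) = 0 := by
  have h := integral_diag_mul_conj_diag_twist (twist_mem hij) i j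
  rw [if_pos (rfl : i = i), if_neg hij.symm, if_pos (rfl : j = j)] at h
  have hc : Complex.I * conj (-Complex.I) = -1 := by rw [map_neg, Complex.conj_I, neg_neg, Complex.I_mul_I]
  rw [hc] at h
  have : (2 : ℂ) * ∫ U, (U : Matrix (Fin N) (Fin N) ℂ) i i * conj ((U : Matrix (Fin N) (Fin N) ℂ) j j) ∂(haarProbability (Matrix.specialUnitaryGroup (Fin N) ℂ)) = 0 := by
    linear_combination h
  exact (mul_eq_zero.1 this).resolve_left two_ne_zero

/-- The triple twist `E_{ijk}`: `I` at `i` and at `j`, `−1` at `k` (pairwise distinct) — an element of `SU(N)` (`I·I·(−1) = 1`). [folklore] -/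
theorem tripleTwist_mem {i j k : Fin N} (hij : i ≠ j) (hik : i ≠ k) (hjk : j ≠ k) :
    Matrix.diagonal (fun l : Fin N => if l = i then Complex.I else if l = j then Complex.I else if l = k then -1 else 1) ∈ Matrix.specialUnitaryGroup (Fin N) ℂ := by
  refine diagonal_mem_specialUnitaryGroup (fun l => ?_) ?_
  · by_cases h1 : l = i
    · simp [h1, Complex.conj_I]
    · by_cases h2 : l = j
      · simp [h2, hij.symm, Complex.conj_I]
      · by_cases h3 : l = k
        · simp [h3, hik.symm, hjk.symm]
        · simp [h1, h2, h3]
  · have hk : k ∈ (Finset.univ.erase i).erase j := by simp [hik.symm, hjk.symm]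
    rw [← Finset.mul_prod_erase _ _ (Finset.mem_univ i), ← Finset.mul_prod_erase _ _ (Finset.mem_erase.2 ⟨hij.symm, Finset.mem_univ j⟩),
      ← Finset.mul_prod_erase _ _ hk]
    rw [Finset.prod_eq_one]
    · simp [hij.symm, hik.symm, hjk.symm, Complex.I_mul_I]
    · intro l hl
      simp only [Finset.mem_erase] at hl
      simp [hl.1, hl.2.1, hl.2.2.1]

/-- **`∫ Uᵢᵢ² dHaar_{SU(N)} = 0`** for `N ≥ 2` (the twist `T_{ik}`, `k ≠ i`, multiplies it by `I² = −1`). [folklore] -/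
theorem integral_diag_sq_eq_zero {i k : Fin N} (hik : i ≠ k) :
    ∫ U, (U : Matrix (Fin N) (Fin N) ℂ) i i * (U : Matrix (Fin N) (Fin N) ℂ) i i ∂(haarProbability (Matrix.specialUnitaryGroup (Fin N) ℂ)) = 0 := by
  have h := integral_diag_mul_diag_twist (twist_mem hik) i i
  rw [if_pos (rfl : i = i), Complex.I_mul_I] at h
  have : (2 : ℂ) * ∫ U, (U : Matrix (Fin N) (Fin N) ℂ) i i * (U : Matrix (Fin N) (Fin N) ℂ) i i ∂(haarProbability (Matrix.specialUnitaryGroup (Fin N) ℂ)) = 0 := by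
    linear_combination h
  exact (mul_eq_zero.1 this).resolve_left two_ne_zero

/-- **`∫ Uᵢᵢ·Uⱼⱼ dHaar_{SU(N)} = 0`** for `i ≠ j` and a third index `k` (so `N ≥ 3`; the triple twist multiplies it by `I·I = −1`). [folklore] -/
theorem integral_diag_mul_diag_eq_zero {i j k : Fin N} (hij : i ≠ j) (hik : i ≠ k) (hjk : j ≠ k) :
    ∫ U, (U : Matrix (Fin N) (Fin N) ℂ) i i * (U : Matrix (Fin N) (Fin N) ℂ) j j ∂(haarProbability (Matrix.specialUnitaryGroup (Fin N) ℂ)) = 0 := by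
  have h := integral_diag_mul_diag_twist (tripleTwist_mem hij hik hjk) i j
  rw [if_pos (rfl : i = i), if_neg hij.symm, if_pos (rfl : j = j), Complex.I_mul_I] at h
  have : (2 : ℂ) * ∫ U, (U : Matrix (Fin N) (Fin N) ℂ) i i * (U : Matrix (Fin N) (Fin N) ℂ) j j ∂(haarProbability (Matrix.specialUnitaryGroup (Fin N) ℂ)) = 0 := by
    linear_combination h
  exact (mul_eq_zero.1 this).resolve_left two_ne_zero

/-! ## §3 Column symmetry by a signed transposition, and the row sum -/

/-- Permutation matrices are unitary. [folklore] -/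
theorem permMatrix_mem_unitaryGroup (σ : Equiv.Perm (Fin N)) : (σ.permMatrix ℂ : Matrix (Fin N) (Fin N) ℂ) ∈ Matrix.unitaryGroup (Fin N) ℂ := by
  rw [Matrix.mem_unitaryGroup_iff, Matrix.star_eq_conjTranspose, Matrix.conjTranspose_permMatrix, ← Matrix.permMatrix_mul, inv_mul_cancel,
    Matrix.permMatrix_one]

/-- The signed transposition `S_{ij} = P_{(ij)}·diag(−1 at i)` (`i ≠ j`) lies in `SU(N)`. [folklore] -/
theorem signedSwap_mem {i j : Fin N} (hij : i ≠ j) :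
    ((Equiv.swap i j).permMatrix ℂ * Matrix.diagonal (fun k : Fin N => if k = i then (-1 : ℂ) else 1)) ∈ Matrix.specialUnitaryGroup (Fin N) ℂ := by
  have hD : Matrix.diagonal (fun k : Fin N => if k = i then (-1 : ℂ) else 1) ∈ Matrix.unitaryGroup (Fin N) ℂ := by
    rw [Matrix.mem_unitaryGroup_iff, Matrix.star_eq_conjTranspose, Matrix.diagonal_conjTranspose, Matrix.diagonal_mul_diagonal, ← Matrix.diagonal_one]
    congr 1; funext k
    by_cases hk : k = i <;> simp [hk]
  rw [Matrix.mem_specialUnitaryGroup_iff]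
  refine ⟨Submonoid.mul_mem _ (permMatrix_mem_unitaryGroup _) hD, ?_⟩
  rw [Matrix.det_mul, Matrix.det_permutation, Matrix.det_diagonal, Equiv.Perm.sign_swap hij]
  rw [← Finset.mul_prod_erase _ _ (Finset.mem_univ i), Finset.prod_eq_one (fun k hk => by rw [if_neg (Finset.ne_of_mem_erase hk)])]
  simp

/-- Entries of a right signed swap in column `i`: `(U·S_{ij})_{a i} = −U_{a j}`. [folklore] -/
theorem mul_signedSwap_apply {i j : Fin N} (M : Matrix (Fin N) (Fin N) ℂ) (a : Fin N) :
    (M * ((Equiv.swap i j).permMatrix ℂ * Matrix.diagonal (fun k : Fin N => if k = i then (-1 : ℂ) else 1))) a i = -M a j := by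
  rw [← Matrix.mul_assoc, Matrix.mul_diagonal, if_pos rfl, Equiv.Perm.permMatrix, PEquiv.mul_toMatrix_toPEquiv, Matrix.submatrix_apply, id,
    Equiv.symm_swap, Equiv.swap_apply_left, mul_neg_one]

/-- **COLUMN SYMMETRY OF THE SQUARED ENTRIES**: for `i ≠ j`, `∫ Uᵢᵢ·conj(Uᵢᵢ) dHaar = ∫ Uᵢⱼ·conj(Uᵢⱼ) dHaar` (right invariance under the signed swap `S_{ij}`:
`(U·S)ᵢᵢ = −Uᵢⱼ`). [folklore] -/
theorem integral_normSq_diag_eq_offdiag {i j : Fin N} (hij : i ≠ j) :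
    ∫ U, (U : Matrix (Fin N) (Fin N) ℂ) i i * conj ((U : Matrix (Fin N) (Fin N) ℂ) i i) ∂(haarProbability (Matrix.specialUnitaryGroup (Fin N) ℂ))
      = ∫ U, (U : Matrix (Fin N) (Fin N) ℂ) i j * conj ((U : Matrix (Fin N) (Fin N) ℂ) i j) ∂(haarProbability (Matrix.specialUnitaryGroup (Fin N) ℂ)) := by
  set g : Matrix.specialUnitaryGroup (Fin N) ℂ := ⟨_, signedSwap_mem hij⟩ with hg
  have h := integral_mul_right_eq_self (μ := haarProbability (Matrix.specialUnitaryGroup (Fin N) ℂ))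
    (fun U : Matrix.specialUnitaryGroup (Fin N) ℂ => (U : Matrix (Fin N) (Fin N) ℂ) i i * conj ((U : Matrix (Fin N) (Fin N) ℂ) i i)) g
  rw [← h]
  refine integral_congr_ae (ae_of_all _ fun U => ?_)
  simp only [hg, Submonoid.coe_mul, mul_signedSwap_apply, map_neg, neg_mul_neg]

/-- **ROW SUM**: `Σ_j Uᵢⱼ·conj(Uᵢⱼ) = 1` for `U ∈ SU(N)` (`U·Uᴴ = 1`). [folklore] -/
theorem sum_row_normSq_eq_one (U : Matrix.specialUnitaryGroup (Fin N) ℂ) (i : Fin N) :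
    ∑ j, (U : Matrix (Fin N) (Fin N) ℂ) i j * conj ((U : Matrix (Fin N) (Fin N) ℂ) i j) = 1 := by
  have hU : (U : Matrix (Fin N) (Fin N) ℂ) ∈ Matrix.unitaryGroup (Fin N) ℂ := (Matrix.mem_specialUnitaryGroup_iff.1 U.2).1
  have h := Matrix.mem_unitaryGroup_iff.1 hU
  have h2 := congrFun (congrFun h i) i
  rw [Matrix.mul_apply, Matrix.one_apply_eq] at h2
  simpa [Matrix.star_apply] using h2

/-- **`∫ |Uᵢᵢ|² dHaar_{SU(N)} = 1∕N`** (`N ≥ 1`; row sum + column symmetry). [folklore] -/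
theorem integral_normSq_diag (i : Fin N) :
    ∫ U, (U : Matrix (Fin N) (Fin N) ℂ) i i * conj ((U : Matrix (Fin N) (Fin N) ℂ) i i) ∂(haarProbability (Matrix.specialUnitaryGroup (Fin N) ℂ)) = 1 / (N : ℂ) := by
  set μ := haarProbability (Matrix.specialUnitaryGroup (Fin N) ℂ) with hμ
  have hint : ∀ j : Fin N, Integrable (fun U : Matrix.specialUnitaryGroup (Fin N) ℂ => (U : Matrix (Fin N) (Fin N) ℂ) i j * conj ((U : Matrix (Fin N) (Fin N) ℂ) i j)) μ :=
    fun j => by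
      have hc : Continuous fun U : Matrix.specialUnitaryGroup (Fin N) ℂ => (U : Matrix (Fin N) (Fin N) ℂ) i j * conj ((U : Matrix (Fin N) (Fin N) ℂ) i j) :=
        ((continuous_apply_apply i j).comp continuous_subtype_val).mul (Complex.continuous_conj.comp ((continuous_apply_apply i j).comp continuous_subtype_val))
      exact hc.integrable_of_hasCompactSupport (HasCompactSupport.of_compactSpace _)
  have hsum : ∑ j, ∫ U, (U : Matrix (Fin N) (Fin N) ℂ) i j * conj ((U : Matrix (Fin N) (Fin N) ℂ) i j) ∂μ = 1 := by
    rw [← integral_finsetSum _ (fun j _ => hint j)]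
    simp_rw [sum_row_normSq_eq_one]
    simp [probReal_univ]
  have hall : ∀ j : Fin N, ∫ U, (U : Matrix (Fin N) (Fin N) ℂ) i j * conj ((U : Matrix (Fin N) (Fin N) ℂ) i j) ∂μ
      = ∫ U, (U : Matrix (Fin N) (Fin N) ℂ) i i * conj ((U : Matrix (Fin N) (Fin N) ℂ) i i) ∂μ := fun j => by
    by_cases hij : i = j
    · subst hij; rfl
    · exact (integral_normSq_diag_eq_offdiag hij).symm
  simp_rw [hall] at hsum
  rw [Finset.sum_const, Finset.card_univ, Fintype.card_fin, nsmul_eq_mul] at hsum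
  have hN : (N : ℂ) ≠ 0 := by
    intro h0
    rw [h0, zero_mul] at hsum
    exact zero_ne_one hsum
  field_simp
  rw [mul_comm] ; exact hsum

/-! ## §4 The character: `∫ |tr U|² = 1`, `∫ (tr U)² = 0` (`N ≥ 3`), and the action variance `½` -/

/-- Integrability of products of two (possibly conjugated) entries against Haar (continuous on a compact group). -/
theorem integrable_entry_mul (f g : Matrix (Fin N) (Fin N) ℂ → ℂ) (hf : Continuous f) (hg : Continuous g) :
    Integrable (fun U : Matrix.specialUnitaryGroup (Fin N) ℂ => f (U : Matrix (Fin N) (Fin N) ℂ) * g (U : Matrix (Fin N) (Fin N) ℂ))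
      (haarProbability (Matrix.specialUnitaryGroup (Fin N) ℂ)) :=
  ((hf.comp continuous_subtype_val).mul (hg.comp continuous_subtype_val)).integrable_of_hasCompactSupport (HasCompactSupport.of_compactSpace _)

/-- **THE FUNDAMENTAL CHARACTER HAS HAAR NORM ONE**: `∫ tr U·conj(tr U) dHaar_{SU(N)}(U) = 1` for every `N ≥ 1` — Schur orthogonality of the fundamental
representation from left∕right invariance alone (torus twists kill the cross terms, a signed swap equalises the squared entries of a row, unitarity sums them to one). [folklore] -/
theorem integral_trace_mul_conj_trace [NeZero N] :
    ∫ U, Matrix.trace (U : Matrix (Fin N) (Fin N) ℂ) * conj (Matrix.trace (U : Matrix (Fin N) (Fin N) ℂ)) ∂(haarProbability (Matrix.specialUnitaryGroup (Fin N) ℂ)) = 1 := by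
  set μ := haarProbability (Matrix.specialUnitaryGroup (Fin N) ℂ) with hμ
  have hexp : ∀ U : Matrix.specialUnitaryGroup (Fin N) ℂ, Matrix.trace (U : Matrix (Fin N) (Fin N) ℂ) * conj (Matrix.trace (U : Matrix (Fin N) (Fin N) ℂ))
      = ∑ i, ∑ j, (U : Matrix (Fin N) (Fin N) ℂ) i i * conj ((U : Matrix (Fin N) (Fin N) ℂ) j j) := fun U => by
    simp only [Matrix.trace, Matrix.diag_apply, map_sum, Finset.sum_mul, Finset.mul_sum]
    rw [Finset.sum_comm]
  simp_rw [hexp]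
  have hint : ∀ i j : Fin N, Integrable (fun U : Matrix.specialUnitaryGroup (Fin N) ℂ => (U : Matrix (Fin N) (Fin N) ℂ) i i * conj ((U : Matrix (Fin N) (Fin N) ℂ) j j)) μ :=
    fun i j => integrable_entry_mul (fun M => M i i) (fun M => conj (M j j)) (continuous_apply_apply i i) (Complex.continuous_conj.comp (continuous_apply_apply j j))
  rw [integral_finsetSum _ (fun i _ => integrable_finsetSum _ (fun j _ => hint i j))]
  simp_rw [integral_finsetSum _ (fun j _ => hint _ j)]
  have hdiag : ∀ i : Fin N, ∑ j, ∫ U, (U : Matrix (Fin N) (Fin N) ℂ) i i * conj ((U : Matrix (Fin N) (Fin N) ℂ) j j) ∂μ = 1 / (N : ℂ) := fun i => by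
    rw [Finset.sum_eq_single i]
    · exact integral_normSq_diag i
    · intro j _ hji; exact integral_diag_mul_conj_diag_eq_zero (Ne.symm hji)
    · intro h; exact absurd (Finset.mem_univ i) h
  simp_rw [hdiag]
  rw [Finset.sum_const, Finset.card_univ, Fintype.card_fin, nsmul_eq_mul]
  have hN : (N : ℂ) ≠ 0 := Nat.cast_ne_zero.2 (NeZero.ne N)
  field_simp

/-- **`∫ (tr U)² dHaar_{SU(N)}(U) = 0` FOR `N ≥ 3`** (every term `∫ Uᵢᵢ·Uⱼⱼ` is killed by a torus twist; for `i ≠ j` a third index is needed). [folklore] -/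
theorem integral_trace_sq_eq_zero (hN : 3 ≤ N) :
    ∫ U, Matrix.trace (U : Matrix (Fin N) (Fin N) ℂ) * Matrix.trace (U : Matrix (Fin N) (Fin N) ℂ) ∂(haarProbability (Matrix.specialUnitaryGroup (Fin N) ℂ)) = 0 := by
  set μ := haarProbability (Matrix.specialUnitaryGroup (Fin N) ℂ) with hμ
  have hexp : ∀ U : Matrix.specialUnitaryGroup (Fin N) ℂ, Matrix.trace (U : Matrix (Fin N) (Fin N) ℂ) * Matrix.trace (U : Matrix (Fin N) (Fin N) ℂ)
      = ∑ i, ∑ j, (U : Matrix (Fin N) (Fin N) ℂ) i i * (U : Matrix (Fin N) (Fin N) ℂ) j j := fun U => by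
    simp only [Matrix.trace, Matrix.diag_apply, Finset.sum_mul, Finset.mul_sum]
    rw [Finset.sum_comm]
  simp_rw [hexp]
  have hint : ∀ i j : Fin N, Integrable (fun U : Matrix.specialUnitaryGroup (Fin N) ℂ => (U : Matrix (Fin N) (Fin N) ℂ) i i * (U : Matrix (Fin N) (Fin N) ℂ) j j) μ :=
    fun i j => integrable_entry_mul (fun M => M i i) (fun M => M j j) (continuous_apply_apply i i) (continuous_apply_apply j j)
  rw [integral_finsetSum _ (fun i _ => integrable_finsetSum _ (fun j _ => hint i j))]
  simp_rw [integral_finsetSum _ (fun j _ => hint _ j)]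
  refine Finset.sum_eq_zero fun i _ => Finset.sum_eq_zero fun j _ => ?_
  obtain ⟨k, hk⟩ : (({i, j} : Finset (Fin N))ᶜ).Nonempty := by
    rw [← Finset.card_pos, Finset.card_compl, Fintype.card_fin]
    have := Finset.card_insert_le i ({j} : Finset (Fin N)); rw [Finset.card_singleton] at this; omega
  rw [Finset.mem_compl, Finset.mem_insert, Finset.mem_singleton, not_or] at hk
  obtain ⟨hki, hkj⟩ := hk
  by_cases hij : i = j
  · subst hij; exact integral_diag_sq_eq_zero (Ne.symm hki)
  · exact integral_diag_mul_diag_eq_zero hij (Ne.symm hki) (Ne.symm hkj)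

/-! ## §5 The reference state's one-plaquette action: variance `½` for `N ≥ 3`, and Chebyshev -/

/-- `(Re z)² = (Re(z·conj z) + Re(z·z))∕2`. -/
theorem re_sq_eq (z : ℂ) : z.re ^ 2 = ((z * conj z).re + (z * z).re) / 2 := by
  simp only [Complex.mul_re, Complex.conj_re, Complex.conj_im]
  ring

/-- **`∫ (Re tr U)² dHaar_{SU(N)}(U) = ½` FOR `N ≥ 3`** (`= ½(∫|tr U|² + Re∫(tr U)²) = ½(1 + 0)`; for `N = 2` the value is `1`, V40e's Weyl formula — not treated here). [folklore] -/
theorem integral_re_trace_sq (hN : 3 ≤ N) :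
    ∫ U, (Matrix.trace (U : Matrix (Fin N) (Fin N) ℂ)).re ^ 2 ∂(haarProbability (Matrix.specialUnitaryGroup (Fin N) ℂ)) = 1 / 2 := by
  haveI : NeZero N := ⟨by omega⟩
  set μ := haarProbability (Matrix.specialUnitaryGroup (Fin N) ℂ) with hμ
  have h1 := integral_trace_mul_conj_trace (N := N)
  have h2 := integral_trace_sq_eq_zero hN
  have i1 : Integrable (fun U : Matrix.specialUnitaryGroup (Fin N) ℂ => Matrix.trace (U : Matrix (Fin N) (Fin N) ℂ) * conj (Matrix.trace (U : Matrix (Fin N) (Fin N) ℂ))) μ :=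
    integrable_entry_mul (fun M => Matrix.trace M) (fun M => conj (Matrix.trace M)) (continuous_id.matrix_trace) (Complex.continuous_conj.comp continuous_id.matrix_trace)
  have i2 : Integrable (fun U : Matrix.specialUnitaryGroup (Fin N) ℂ => Matrix.trace (U : Matrix (Fin N) (Fin N) ℂ) * Matrix.trace (U : Matrix (Fin N) (Fin N) ℂ)) μ :=
    integrable_entry_mul (fun M => Matrix.trace M) (fun M => Matrix.trace M) (continuous_id.matrix_trace) (continuous_id.matrix_trace)
  have r1 := integral_re i1
  have r2 := integral_re i2
  simp only [RCLike.re_to_complex] at r1 r2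
  have i1r : Integrable (fun U : Matrix.specialUnitaryGroup (Fin N) ℂ => (Matrix.trace (U : Matrix (Fin N) (Fin N) ℂ) * conj (Matrix.trace (U : Matrix (Fin N) (Fin N) ℂ))).re) μ := i1.re
  have i2r : Integrable (fun U : Matrix.specialUnitaryGroup (Fin N) ℂ => (Matrix.trace (U : Matrix (Fin N) (Fin N) ℂ) * Matrix.trace (U : Matrix (Fin N) (Fin N) ℂ)).re) μ := i2.re
  simp_rw [re_sq_eq]
  rw [integral_div, integral_add i1r i2r]
  rw [show (∫ a, (Matrix.trace (a : Matrix (Fin N) (Fin N) ℂ) * conj (Matrix.trace (a : Matrix (Fin N) (Fin N) ℂ))).re ∂μ) = 1 by rw [r1, h1]; simp,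
    show (∫ a, (Matrix.trace (a : Matrix (Fin N) (Fin N) ℂ) * Matrix.trace (a : Matrix (Fin N) (Fin N) ℂ)).re ∂μ) = 0 by rw [r2, h2]; simp]
  norm_num

/-- **THE REFERENCE STATE's ACTION VARIANCE IS `½` FOR `N ≥ 3`**: `∫ (Re tr(1−U) − N)² dHaar_{SU(N)}(U) = ½` (the mean is `N`, V46). [folklore] -/
theorem integral_sq_traceDeficit_sub_mean (hN : 3 ≤ N) :
    ∫ U, ((Matrix.trace (1 - (U : Matrix (Fin N) (Fin N) ℂ))).re - (N : ℝ)) ^ 2 ∂(haarProbability (Matrix.specialUnitaryGroup (Fin N) ℂ)) = 1 / 2 := by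
  have hre : ∀ U : Matrix.specialUnitaryGroup (Fin N) ℂ, ((Matrix.trace (1 - (U : Matrix (Fin N) (Fin N) ℂ))).re - (N : ℝ)) ^ 2 = (Matrix.trace (U : Matrix (Fin N) (Fin N) ℂ)).re ^ 2 :=
    fun U => by
      rw [Matrix.trace_sub, Matrix.trace_one, Complex.sub_re, Fintype.card_fin, Complex.natCast_re]; ring
  simp_rw [hre]
  exact integral_re_trace_sq hN

/-- Markov step: `Haar_{SU(N)}{t² ≤ (Re tr(1−U) − N)²} ≤ (1∕2)∕t²` for `t > 0`, `N ≥ 3`. [folklore] -/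
theorem haarReal_sq_traceDeficit_sub_mean_ge_le (hN : 3 ≤ N) {t : ℝ} (ht : 0 < t) :
    (haarProbability (Matrix.specialUnitaryGroup (Fin N) ℂ)).real
        {U : Matrix.specialUnitaryGroup (Fin N) ℂ | t ^ 2 ≤ ((Matrix.trace (1 - (U : Matrix (Fin N) (Fin N) ℂ))).re - (N : ℝ)) ^ 2} ≤ (1 / 2) / t ^ 2 := by
  have hfc : Continuous fun U : Matrix.specialUnitaryGroup (Fin N) ℂ => ((Matrix.trace (1 - (U : Matrix (Fin N) (Fin N) ℂ))).re - (N : ℝ)) ^ 2 :=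
    ((Complex.continuous_re.comp ((continuous_const.sub continuous_subtype_val).matrix_trace)).sub continuous_const).pow 2
  have hfi : Integrable (fun U : Matrix.specialUnitaryGroup (Fin N) ℂ => ((Matrix.trace (1 - (U : Matrix (Fin N) (Fin N) ℂ))).re - (N : ℝ)) ^ 2)
      (haarProbability (Matrix.specialUnitaryGroup (Fin N) ℂ)) := hfc.integrable_of_hasCompactSupport (HasCompactSupport.of_compactSpace _)
  have hmarkov := mul_meas_ge_le_integral_of_nonneg (μ := haarProbability (Matrix.specialUnitaryGroup (Fin N) ℂ)) (ae_of_all _ fun U => sq_nonneg _) hfi (t ^ 2)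
  beta_reduce at hmarkov
  rw [integral_sq_traceDeficit_sub_mean hN] at hmarkov
  rw [le_div_iff₀ (by positivity : (0 : ℝ) < t ^ 2), mul_comm]
  exact hmarkov

/-- **CHEBYSHEV FOR THE REFERENCE STATE's ACTION, `N ≥ 3`**: `Haar_{SU(N)}{t ≤ |Re tr(1−U) − N|} ≤ 1∕(2t²)` for `t > 0`. [folklore] -/
theorem haarReal_abs_traceDeficit_sub_mean_ge_le (hN : 3 ≤ N) {t : ℝ} (ht : 0 < t) :
    (haarProbability (Matrix.specialUnitaryGroup (Fin N) ℂ)).real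
        {U : Matrix.specialUnitaryGroup (Fin N) ℂ | t ≤ |(Matrix.trace (1 - (U : Matrix (Fin N) (Fin N) ℂ))).re - (N : ℝ)|} ≤ 1 / (2 * t ^ 2) := by
  have hmono : (haarProbability (Matrix.specialUnitaryGroup (Fin N) ℂ)).real
        {U : Matrix.specialUnitaryGroup (Fin N) ℂ | t ≤ |(Matrix.trace (1 - (U : Matrix (Fin N) (Fin N) ℂ))).re - (N : ℝ)|}
      ≤ (haarProbability (Matrix.specialUnitaryGroup (Fin N) ℂ)).real
        {U : Matrix.specialUnitaryGroup (Fin N) ℂ | t ^ 2 ≤ ((Matrix.trace (1 - (U : Matrix (Fin N) (Fin N) ℂ))).re - (N : ℝ)) ^ 2} :=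
    measureReal_mono fun U hU => by
      have hU' : t ≤ |(Matrix.trace (1 - (U : Matrix (Fin N) (Fin N) ℂ))).re - (N : ℝ)| := hU
      have h := pow_le_pow_left₀ ht.le hU' 2
      rw [sq_abs] at h
      exact h
  have h4 : (1 / 2 : ℝ) / t ^ 2 = 1 / (2 * t ^ 2) := by rw [div_div]
  exact hmono.trans ((haarReal_sq_traceDeficit_sub_mean_ge_le hN ht).trans_eq h4)

/-! ## §6 `N = 2`: the second moment is `1` (V40e's Weyl formula by name) — the table `Var = 1 (N = 2), ½ (N ≥ 3)` -/

/-- **`∫ (Re tr U)² dHaar_{SU(2)}(U) = 1`** (Weyl: `(2∕π)∫₀^π (2cos ψ)² sin²ψ dψ = (8∕π)·(π∕8)`; `tr U` is real on `SU(2)`, `V ≅ V*`, so `∫(tr U)² = ∫|tr U|² = 1` — the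
exceptional case of §4∕§5). [folklore] -/
theorem integral_re_trace_sq_SU2 :
    ∫ U, (Matrix.trace (U : Matrix (Fin 2) (Fin 2) ℂ)).re ^ 2 ∂(haarProbability (Matrix.specialUnitaryGroup (Fin 2) ℂ)) = 1 := by
  have hπ := Real.pi_pos
  have h := integral_haar_su2_classFun (fun x : ℝ => x ^ 2) (measurable_id.pow_const 2) (fun x => sq_nonneg x) (M := 4)
    (fun x h1 h2 => by nlinarith)
  rw [h, setIntegral_Ioo_eq_intervalIntegral]
  have hI : ∫ ψ in (0 : ℝ)..Real.pi, (2 * Real.cos ψ) ^ 2 * Real.sin ψ ^ 2 = Real.pi / 2 := by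
    have e : (fun ψ : ℝ => (2 * Real.cos ψ) ^ 2 * Real.sin ψ ^ 2) = fun ψ => 4 * (Real.sin ψ ^ 2 * Real.cos ψ ^ 2) := by funext ψ; ring
    rw [e, intervalIntegral.integral_const_mul, integral_sin_sq_mul_cos_sq]
    have h4 : Real.sin (4 * Real.pi) = 0 := by exact_mod_cast Real.sin_nat_mul_pi 4
    rw [h4, mul_zero, Real.sin_zero]; ring
  rw [hI]; field_simp

/-- **THE REFERENCE STATE's ACTION VARIANCE ON `SU(2)` IS `1`**: `∫ (Re tr(1−U) − 2)² dHaar_{SU(2)}(U) = 1` (mean `2`, V46). [folklore] -/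
theorem integral_sq_traceDeficit_sub_mean_SU2 :
    ∫ U, ((Matrix.trace (1 - (U : Matrix (Fin 2) (Fin 2) ℂ))).re - (2 : ℝ)) ^ 2 ∂(haarProbability (Matrix.specialUnitaryGroup (Fin 2) ℂ)) = 1 := by
  have hre : ∀ U : Matrix.specialUnitaryGroup (Fin 2) ℂ, ((Matrix.trace (1 - (U : Matrix (Fin 2) (Fin 2) ℂ))).re - (2 : ℝ)) ^ 2 = (Matrix.trace (U : Matrix (Fin 2) (Fin 2) ℂ)).re ^ 2 :=
    fun U => by
      rw [Matrix.trace_sub, Matrix.trace_one, Complex.sub_re, Fintype.card_fin]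
      norm_num
  simp_rw [hre]
  exact integral_re_trace_sq_SU2

end Summit.QuantumFields.BalabanUV.T4Continuum.NE7b.CompactFibreCharacterNormSUN

end
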